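import Literature.NumberTheory.Automorphic.UnitaryGroupOrbitalFiniteness
import Literature.NumberTheory.Automorphic.AutomorphicQuotientDiagonalTrace
import Literature.NumberTheory.Rogawski1990.StableClassRegrouping
import HarnessLib

/-!
# The trace functional of the anisotropic inner form `U(H)` equals its orbital expansion:
`θ_{G′}(F) = C · Σ_{[γ]} d_{[γ]} O_{[γ]}(F)` for every test function `F`
(Rogawski, *Automorphic representations of unitary groups in three variables* (1990), §14.5 p. 237
(print): `T_{G′}(f′) = tr ρ(f′) = Σ_{𝒪} J(𝒪, f′)`; Gelbart (1975), (9.11)–(9.13))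

Topic `NumberTheory/Automorphic`; namespace `Literature.NumberTheory.Automorphic.UnitaryGroup`.
Proof file: theorems only, no definition, no named fact, no `sorry`, no instance attribute;
imports = tree.

The tree NAMES the trace functional of the inner form: `UnitaryGroup.diagTrace L N H μ ν hanis`
(`AutomorphicQuotientDiagonalTrace`: `θ(F) = c⁻¹ ∫_X K_F(x, x) dμ`, kernel for the counting measure on
the discrete `U(H)(L⁺)`, `c = unfoldingConstant`; on `F = f ⋆ f^*` it is `Σ_i ‖R(f) e_i‖²`), and HAS
the geometric side of `∫_X K_F(x, x) dμ` (`UnitaryGroupGeometricSide`,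
`integral_quotientKernel_diag_eq_mul_tsum_cmDatum`) and its finiteness in the classes
(`UnitaryGroupOrbitalFiniteness`). This file composes them into the identity of functionals on ALL
of `C_c(U(H)(𝔸_{L⁺}))` — the shape of the line's `SimpleTraceFormula` (`θ_{G′} = J_{G′}`, finitely
supported in the classes) for the CONCRETE trace functional and CONCRETE orbital terms:

* `UnitaryGroup.diagTrace_eq_const_mul_tsum_orbital` — there are `C > 0`, `d_c ∈ (0, ∞)` and
  non-zero invariant measures `μ_c` on `U(H)(𝔸) ⧸ U(H)(𝔸)_{γ_c}` (`γ_c = out c`, `c` the conjugacy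
  classes of `U(H)(L⁺)`) such that for EVERY `F ∈ C_c(U(H)(𝔸))`: the orbital integrals
  `O_{γ_c}(F) = ∫ F(y γ_c y⁻¹) dμ_c` converge absolutely, `Σ_c d_c O_{γ_c}(|F|) < ∞`, and
  `θ(F) = C · Σ'_c d_c O_{γ_c}(F)`;
* `UnitaryGroup.diagTrace_eq_const_mul_sum_orbital` — and for each `F` a finite set `s_F` of
  classes off which the orbital integrands vanish identically, with
  `θ(F) = C · Σ_{c ∈ s_F} d_c O_{γ_c}(F)`;
* `UnitaryGroup.diagTrace_eq_finsum_orbital` — class-function form: `c ↦ C d_c O_{γ_c}(F)` is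
  finitely supported and `θ(F) = Σᶠ_c C d_c O_{γ_c}(F)` (the input of the stable regrouping
  `Σᶠ_c Φ(c) = Σᶠ_{𝒪_st} Σ_{c ⊂ 𝒪_st} Φ(c)`, `Rogawski1990/StableClassRegrouping`);
* `UnitaryGroup.diagTrace_eq_finsum_conjClasses_rational` — the same indexed by the conjugacy
  classes of the RATIONAL group `U(H)(L⁺) = ↥(unitaryGroup (cmConjRingHom L) H)` (the index type of
  `StableConjugacyU3`), via the bijection of classes induced by the diagonal embedding (given as a
  witness `e` with `e [γ] = [toAdelic γ]`; `Rogawski1990.bijective_conjClassesMap_of_mulEquiv`);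
* `UnitaryGroup.diagTrace_eq_finsum_stableClass_orbitalSum` — **`θ_{G′}(F) = Σ_{𝒪_st} J(𝒪_st, F)`**:
  regrouped by STABLE classes with `Rogawski1990.finsum_stableClass_orbitalSum`
  (`StableClassRegrouping`) — the law `SimpleTraceFormula` of the floor-0 line for the concrete
  trace functional and concrete grouped orbital terms.

CAVEAT (inherited): `C = c⁻¹ κ`, `d_c` and `μ_c` are not normalised (the printed `a_γ` are Tamagawa
volumes); no grouping into stable classes.

## References

* J. D. Rogawski, *Automorphic Representations of Unitary Groups in Three Variables*, Ann. of Math.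
  Stud. 123 (1990), §14.5 p. 237 (print) [Rogawski1990].
* S. Gelbart, *Automorphic forms on adele groups*, Ann. of Math. Stud. 83 (1975), (9.11)–(9.13),
  Remark 9.23 [Gelbart1975].
-/

noncomputable section

open MeasureTheory Measure Set Filter Topology NumberField CompactlySupported
open Literature.MeasureTheory.Group
open scoped ENNReal NNReal Pointwise

namespace Literature.NumberTheory.Automorphic

namespace UnitaryGroup

open Literature.AlgebraicGeometry.ShimuraVarieties (hermForm)

variable (L : Type) [Field L] [NumberField L] [IsCMField L] (N : ℕ) (H : Matrix (Fin N) (Fin N) L)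
  [MeasurableSpace (cmDatum L N H).Adelic] [BorelSpace (cmDatum L N H).Adelic]
  [∀ γ : (cmDatum L N H).Adelic, MeasurableSpace ((cmDatum L N H).Adelic ⧸
    Subgroup.centralizer ({γ} : Set (cmDatum L N H).Adelic))]
  [∀ γ : (cmDatum L N H).Adelic, BorelSpace ((cmDatum L N H).Adelic ⧸
    Subgroup.centralizer ({γ} : Set (cmDatum L N H).Adelic))]
  (μ : Measure (cmDatum L N H).automorphicQuotient) [(cmDatum L N H).IsAutomorphicMeasure μ]
  (ν : Measure (cmDatum L N H).Adelic) [ν.IsHaarMeasure]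

/-- **The trace functional of the inner form equals its orbital expansion** (Rogawski (1990),
§14.5 p. 237 (print): for the anisotropic `G′`, `T_{G′}(f′) = tr ρ(f′)` is the `O`-expansion
`Σ_γ a_γ Φ_γ(f′)`; Gelbart (1975), (9.11)–(9.13)). For `H` anisotropic, `μ` automorphic and `ν` a Haar
measure on `U(H)(𝔸_{L⁺})`: there are `C > 0`, `d_c ∈ (0, ∞)` and non-zero `U(H)(𝔸)`-invariant Borel
measures `μ_c` finite on compact sets on `U(H)(𝔸) ⧸ U(H)(𝔸)_{γ_c}` (`γ_c = out c` over the conjugacy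
classes `c` of `U(H)(L⁺)`) such that for EVERY `F ∈ C_c(U(H)(𝔸_{L⁺}))` the orbital integrals
converge absolutely, the class series converges absolutely, and

  `UnitaryGroup.diagTrace L N H μ ν hanis F = C · Σ'_c d_c ∫ F(y γ_c y⁻¹) dμ_c(y)`

(`diagTrace_eq` + `AdelicGroupData.diagTrace_apply` + `integral_quotientKernel_diag_eq_mul_tsum_cmDatum`
for the counting measure on `U(H)(L⁺)`, a two-sided Haar measure of the discrete group;
`C = c⁻¹ κ`). [cite: Rogawski1990, §14.5 p. 237] -/
theorem diagTrace_eq_const_mul_tsum_orbital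
    (hanis : ∀ x : Fin N → L, hermForm (cmConjRingHom L) H x x = 0 → x = 0) :
    ∃ (C : ℝ≥0) (dc : ConjClasses (cmDatum L N H).arithmeticSubgroup → ℝ≥0∞)
      (μC : ∀ c : ConjClasses (cmDatum L N H).arithmeticSubgroup, Measure ((cmDatum L N H).Adelic ⧸
        Subgroup.centralizer ({((Quotient.out c : (cmDatum L N H).arithmeticSubgroup) :
          (cmDatum L N H).Adelic)} : Set (cmDatum L N H).Adelic))),
      0 < C ∧ (∀ c, dc c ≠ 0 ∧ dc c ≠ ∞) ∧
      (∀ c, SMulInvariantMeasure (cmDatum L N H).Adelic _ (μC c) ∧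
        IsFiniteMeasureOnCompacts (μC c) ∧ μC c ≠ 0) ∧
      ∀ F : C_c((cmDatum L N H).Adelic, ℂ),
        (∀ c, Integrable (descConj ((Quotient.out c : (cmDatum L N H).arithmeticSubgroup) :
            (cmDatum L N H).Adelic)
          (Subgroup.centralizer ({((Quotient.out c : (cmDatum L N H).arithmeticSubgroup) :
            (cmDatum L N H).Adelic)} : Set (cmDatum L N H).Adelic))
          (fun _ hg => Subgroup.mem_centralizer_singleton_iff.1 hg) F) (μC c)) ∧
        Summable (fun c => (dc c).toReal * ∫ y, ‖descConj
          ((Quotient.out c : (cmDatum L N H).arithmeticSubgroup) : (cmDatum L N H).Adelic)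
          (Subgroup.centralizer ({((Quotient.out c : (cmDatum L N H).arithmeticSubgroup) :
            (cmDatum L N H).Adelic)} : Set (cmDatum L N H).Adelic))
          (fun _ hg => Subgroup.mem_centralizer_singleton_iff.1 hg) F y‖ ∂(μC c)) ∧
        diagTrace L N H μ ν hanis F =
          ((C : ℝ) : ℂ) * ∑' c, ((dc c).toReal : ℂ) * ∫ y, descConj
            ((Quotient.out c : (cmDatum L N H).arithmeticSubgroup) : (cmDatum L N H).Adelic)
            (Subgroup.centralizer ({((Quotient.out c : (cmDatum L N H).arithmeticSubgroup) :
              (cmDatum L N H).Adelic)} : Set (cmDatum L N H).Adelic))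
            (fun _ hg => Subgroup.mem_centralizer_singleton_iff.1 hg) F y ∂(μC c) := by
  haveI := compactSpace_cmDatum_automorphicQuotient L N H hanis
  haveI : DiscreteTopology (cmDatum L N H).quotientSubgroup :=
    discreteTopology_cmDatum_quotientSubgroup L N H
  haveI hH : IsClosed ((cmDatum L N H).quotientSubgroup : Set (cmDatum L N H).Adelic) :=
    isClosed_cmDatum_quotientSubgroup L N H
  haveI : Countable (cmDatum L N H).quotientSubgroup := countable_cmDatum_quotientSubgroup L N H
  -- the tree's Borel structure ∕ invariance ∕ finiteness of `μ`, keyed on the form `G(𝔸) ⧸ A_G G(K)`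
  letI := AdelicGroupData.measurableSpaceQuotientForm (cmDatum L N H)
  haveI := AdelicGroupData.borelSpaceQuotientForm (cmDatum L N H)
  haveI := AdelicGroupData.smulInvariantMeasureQuotientForm (cmDatum L N H) μ
  haveI := AdelicGroupData.isFiniteMeasureOnCompactsQuotientForm (cmDatum L N H) μ
  haveI := AdelicGroupData.isFiniteMeasureQuotientForm (cmDatum L N H) μ
  -- the counting measure on the discrete `U(H)(L⁺)` is a two-sided Haar measure
  haveI : (count : Measure (cmDatum L N H).quotientSubgroup).IsHaarMeasure :=
    isHaarMeasure_count_of_discrete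
  have hdisc := cmDatum_isDiscreteRational L N H
  have hθA : ∀ g, (1 : (cmDatum L N H).Adelic →* (cmDatum L N H).Adelic) g ∈ (cmDatum L N H).center' :=
    fun g => by rw [MonoidHom.one_apply]; exact one_mem _
  have hθa : ∀ a ∈ (cmDatum L N H).center',
      (1 : (cmDatum L N H).Adelic →* (cmDatum L N H).Adelic) a = a := fun a ha => by
    rw [cmDatum_center', Subgroup.mem_bot] at ha
    rw [ha, MonoidHom.one_apply]
  haveI : (count : Measure (cmDatum L N H).quotientSubgroup).IsMulRightInvariant :=
    AdelicGroupData.isMulRightInvariant_of_centralRetraction (cmDatum L N H) hdisc 1 continuous_const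
      hθA hθa (fun _ _ => rfl) count
  have hρ0 : (count : Measure (cmDatum L N H).quotientSubgroup) ≠ 0 := fun h => by
    have h2 : 0 < (count : Measure (cmDatum L N H).quotientSubgroup) Set.univ :=
      isOpen_univ.measure_pos count ⟨1, trivial⟩
    rw [h] at h2
    exact lt_irrefl _ h2
  obtain ⟨κ, dc, μC, hκ, hdc, hμC, hΦ⟩ :=
    integral_quotientKernel_diag_eq_mul_tsum_cmDatum L N H hanis μ
      (count : Measure (cmDatum L N H).quotientSubgroup)
  have hcpos : 0 < unfoldingConstant (cmDatum L N H).quotientSubgroup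
      (count : Measure (cmDatum L N H).quotientSubgroup) μ ν :=
    unfoldingConstant_pos (cmDatum L N H).quotientSubgroup count μ ν
      (AdelicGroupData.IsAutomorphicMeasure.ne_zero (cmDatum L N H) μ) hρ0
  refine ⟨(unfoldingConstant (cmDatum L N H).quotientSubgroup
      (count : Measure (cmDatum L N H).quotientSubgroup) μ ν)⁻¹ * κ, dc, μC,
    mul_pos (inv_pos.2 hcpos) hκ, hdc, hμC, fun F => ?_⟩
  obtain ⟨hInt, hSum, hEq⟩ := hΦ F
  refine ⟨hInt, hSum, ?_⟩
  -- `θ(F) = c⁻¹ ∫_X K_F(x, x) dμ` by definition (`diagTrace_eq`, `AdelicGroupData.diagTrace_apply`)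
  have hθ : diagTrace L N H μ ν hanis F =
      (((unfoldingConstant (cmDatum L N H).quotientSubgroup
        (count : Measure (cmDatum L N H).quotientSubgroup) μ ν : ℝ)⁻¹ : ℂ)) *
        ∫ x, quotientKernel (cmDatum L N H).quotientSubgroup
          (count : Measure (cmDatum L N H).quotientSubgroup) F x x ∂μ := rfl
  rw [hθ, hEq, ← mul_assoc]
  congr 1
  push_cast
  ring

/-- **… and the expansion is a FINITE sum for each test function**: with the same `C`, `d_c`, `μ_c`,
for every `F ∈ C_c(U(H)(𝔸_{L⁺}))` there is a finite set `s` of conjugacy classes of `U(H)(L⁺)`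
(those meeting `tsupport F` under `U(H)(𝔸)`-conjugation, `exists_finset_descConj_eq_zero_cmDatum`)
off which the orbital integrands `y ↦ F(y γ_c y⁻¹)` vanish identically, and

  `UnitaryGroup.diagTrace L N H μ ν hanis F = C · Σ_{c ∈ s} d_c ∫ F(y γ_c y⁻¹) dμ_c(y)`

— Rogawski's "`Σ_{𝒪} J(𝒪, f′)`, a finite sum for each `f′`" for the concrete trace functional and
orbital terms of the inner form. [cite: Rogawski1990, §14.5 p. 237] -/
theorem diagTrace_eq_const_mul_sum_orbital
    (hanis : ∀ x : Fin N → L, hermForm (cmConjRingHom L) H x x = 0 → x = 0) :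
    ∃ (C : ℝ≥0) (dc : ConjClasses (cmDatum L N H).arithmeticSubgroup → ℝ≥0∞)
      (μC : ∀ c : ConjClasses (cmDatum L N H).arithmeticSubgroup, Measure ((cmDatum L N H).Adelic ⧸
        Subgroup.centralizer ({((Quotient.out c : (cmDatum L N H).arithmeticSubgroup) :
          (cmDatum L N H).Adelic)} : Set (cmDatum L N H).Adelic))),
      0 < C ∧ (∀ c, dc c ≠ 0 ∧ dc c ≠ ∞) ∧
      (∀ c, SMulInvariantMeasure (cmDatum L N H).Adelic _ (μC c) ∧
        IsFiniteMeasureOnCompacts (μC c) ∧ μC c ≠ 0) ∧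
      ∀ F : C_c((cmDatum L N H).Adelic, ℂ),
        ∃ s : Finset (ConjClasses (cmDatum L N H).arithmeticSubgroup),
          (∀ c ∉ s, descConj ((Quotient.out c : (cmDatum L N H).arithmeticSubgroup) :
              (cmDatum L N H).Adelic)
            (Subgroup.centralizer ({((Quotient.out c : (cmDatum L N H).arithmeticSubgroup) :
              (cmDatum L N H).Adelic)} : Set (cmDatum L N H).Adelic))
            (fun _ hg => Subgroup.mem_centralizer_singleton_iff.1 hg) (⇑F) = 0) ∧
          diagTrace L N H μ ν hanis F =
            ((C : ℝ) : ℂ) * ∑ c ∈ s, ((dc c).toReal : ℂ) * ∫ y, descConj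
              ((Quotient.out c : (cmDatum L N H).arithmeticSubgroup) : (cmDatum L N H).Adelic)
              (Subgroup.centralizer ({((Quotient.out c : (cmDatum L N H).arithmeticSubgroup) :
                (cmDatum L N H).Adelic)} : Set (cmDatum L N H).Adelic))
              (fun _ hg => Subgroup.mem_centralizer_singleton_iff.1 hg) F y ∂(μC c) := by
  obtain ⟨C, dc, μC, hC, hdc, hμC, hF⟩ := diagTrace_eq_const_mul_tsum_orbital L N H μ ν hanis
  refine ⟨C, dc, μC, hC, hdc, hμC, fun F => ?_⟩
  obtain ⟨s, hs⟩ := exists_finset_descConj_eq_zero_cmDatum L N H hanis F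
    (fun c => Subgroup.centralizer ({((Quotient.out c : (cmDatum L N H).arithmeticSubgroup) :
      (cmDatum L N H).Adelic)} : Set (cmDatum L N H).Adelic))
    (fun c => fun _ hg => Subgroup.mem_centralizer_singleton_iff.1 hg)
  refine ⟨s, hs, ?_⟩
  obtain ⟨-, -, hEq⟩ := hF F
  rw [tsum_eq_sum (s := s) fun c hc => by rw [hs c hc, Pi.zero_def, integral_zero, mul_zero]] at hEq
  exact hEq

/-- **Class-function form** (the input shape of the stable regrouping `StableClassRegrouping`,
Rogawski (1990), §14.5 p. 237: `J_{G′}(f′) = Σ_{𝒪} J(𝒪, f′)`, `J(𝒪_st, f′) = Σ_{γ ∈ 𝒪_st} (…) Φ(γ, f′)`):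
with the same data, the CLASS FUNCTION `c ↦ C · d_c · O_{γ_c}(F)` on the conjugacy classes of
`U(H)(L⁺)` is finitely supported for every `F ∈ C_c(U(H)(𝔸_{L⁺}))` and
`θ(F) = Σᶠ_c C · d_c · O_{γ_c}(F)` (a `finsum`). [cite: Rogawski1990, §14.5 p. 237] -/
theorem diagTrace_eq_finsum_orbital
    (hanis : ∀ x : Fin N → L, hermForm (cmConjRingHom L) H x x = 0 → x = 0) :
    ∃ (C : ℝ≥0) (dc : ConjClasses (cmDatum L N H).arithmeticSubgroup → ℝ≥0∞)
      (μC : ∀ c : ConjClasses (cmDatum L N H).arithmeticSubgroup, Measure ((cmDatum L N H).Adelic ⧸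
        Subgroup.centralizer ({((Quotient.out c : (cmDatum L N H).arithmeticSubgroup) :
          (cmDatum L N H).Adelic)} : Set (cmDatum L N H).Adelic))),
      0 < C ∧ (∀ c, dc c ≠ 0 ∧ dc c ≠ ∞) ∧
      (∀ c, SMulInvariantMeasure (cmDatum L N H).Adelic _ (μC c) ∧
        IsFiniteMeasureOnCompacts (μC c) ∧ μC c ≠ 0) ∧
      ∀ F : C_c((cmDatum L N H).Adelic, ℂ),
        (Function.support fun c : ConjClasses (cmDatum L N H).arithmeticSubgroup =>
          ((C : ℝ) : ℂ) * ((dc c).toReal : ℂ) * ∫ y, descConj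
            ((Quotient.out c : (cmDatum L N H).arithmeticSubgroup) : (cmDatum L N H).Adelic)
            (Subgroup.centralizer ({((Quotient.out c : (cmDatum L N H).arithmeticSubgroup) :
              (cmDatum L N H).Adelic)} : Set (cmDatum L N H).Adelic))
            (fun _ hg => Subgroup.mem_centralizer_singleton_iff.1 hg) F y ∂(μC c)).Finite ∧
        diagTrace L N H μ ν hanis F =
          ∑ᶠ c : ConjClasses (cmDatum L N H).arithmeticSubgroup,
            ((C : ℝ) : ℂ) * ((dc c).toReal : ℂ) * ∫ y, descConj
              ((Quotient.out c : (cmDatum L N H).arithmeticSubgroup) : (cmDatum L N H).Adelic)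
              (Subgroup.centralizer ({((Quotient.out c : (cmDatum L N H).arithmeticSubgroup) :
                (cmDatum L N H).Adelic)} : Set (cmDatum L N H).Adelic))
              (fun _ hg => Subgroup.mem_centralizer_singleton_iff.1 hg) F y ∂(μC c) := by
  obtain ⟨C, dc, μC, hC, hdc, hμC, hF⟩ := diagTrace_eq_const_mul_sum_orbital L N H μ ν hanis
  refine ⟨C, dc, μC, hC, hdc, hμC, fun F => ?_⟩
  obtain ⟨s, hs, hEq⟩ := hF F
  have hzero : ∀ c ∉ s, ((C : ℝ) : ℂ) * ((dc c).toReal : ℂ) * ∫ y, descConj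
      ((Quotient.out c : (cmDatum L N H).arithmeticSubgroup) : (cmDatum L N H).Adelic)
      (Subgroup.centralizer ({((Quotient.out c : (cmDatum L N H).arithmeticSubgroup) :
        (cmDatum L N H).Adelic)} : Set (cmDatum L N H).Adelic))
      (fun _ hg => Subgroup.mem_centralizer_singleton_iff.1 hg) F y ∂(μC c) = 0 := fun c hc => by
    rw [hs c hc, Pi.zero_def, integral_zero, mul_zero]
  have hsupp : (Function.support fun c : ConjClasses (cmDatum L N H).arithmeticSubgroup =>
      ((C : ℝ) : ℂ) * ((dc c).toReal : ℂ) * ∫ y, descConj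
        ((Quotient.out c : (cmDatum L N H).arithmeticSubgroup) : (cmDatum L N H).Adelic)
        (Subgroup.centralizer ({((Quotient.out c : (cmDatum L N H).arithmeticSubgroup) :
          (cmDatum L N H).Adelic)} : Set (cmDatum L N H).Adelic))
        (fun _ hg => Subgroup.mem_centralizer_singleton_iff.1 hg) F y ∂(μC c)) ⊆ ↑s := by
    intro c hc
    by_contra hcs
    exact hc (hzero c hcs)
  refine ⟨s.finite_toSet.subset hsupp, ?_⟩
  rw [hEq, finsum_eq_sum_of_support_subset _ hsupp, Finset.mul_sum]
  refine Finset.sum_congr rfl fun c _ => ?_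
  ring

/-- **Indexed by the conjugacy classes of the RATIONAL group `U(H)(L⁺)`** (the index type
`ConjClasses ↥(unitaryGroup (cmConjRingHom L) H)` of the stable-class regrouping of
`Rogawski1990/StableConjugacyU3`, `StableClassRegrouping`): transporting
`diagTrace_eq_finsum_orbital` along the bijection of conjugacy classes induced by the diagonal
embedding `U(H)(L⁺) ≃* (its image in U(H)(𝔸))` (`cmDatum_toAdelic_injective`; the bijection `e` is
part of the conclusion, with its defining property `e [γ] = [toAdelic γ]`): for `H` anisotropic there
are such `e`, `C > 0`, `d_c`, `μ_c` with, for every `F ∈ C_c(U(H)(𝔸_{L⁺}))`, the class function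
`Φ_F : [γ] ↦ C · d_{e[γ]} · O_{e[γ]}(F)` on the classes of `U(H)(L⁺)` finitely supported and
`θ(F) = Σᶠ_{[γ]} Φ_F([γ])` — Rogawski's `T_{G′}(f′) = Σ_{γ} (…) Φ(γ, f′)` over the conjugacy
classes of `G′(F)` [§14.5 p. 237 (print)], the input of `J(𝒪_st, f′) = Σ_{[γ] ⊂ 𝒪_st} Φ_{f′}([γ])`.
[cite: Rogawski1990, §14.5 p. 237] -/
theorem diagTrace_eq_finsum_conjClasses_rational
    (hanis : ∀ x : Fin N → L, hermForm (cmConjRingHom L) H x x = 0 → x = 0) :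
    ∃ (e : ConjClasses (cmDatum L N H).Rational ≃ ConjClasses (cmDatum L N H).arithmeticSubgroup)
      (C : ℝ≥0) (dc : ConjClasses (cmDatum L N H).arithmeticSubgroup → ℝ≥0∞)
      (μC : ∀ c : ConjClasses (cmDatum L N H).arithmeticSubgroup, Measure ((cmDatum L N H).Adelic ⧸
        Subgroup.centralizer ({((Quotient.out c : (cmDatum L N H).arithmeticSubgroup) :
          (cmDatum L N H).Adelic)} : Set (cmDatum L N H).Adelic))),
      (∀ γ : (cmDatum L N H).Rational, e (ConjClasses.mk γ) =
        ConjClasses.mk ⟨(cmDatum L N H).toAdelic γ, ⟨γ, rfl⟩⟩) ∧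
      0 < C ∧ (∀ c, dc c ≠ 0 ∧ dc c ≠ ∞) ∧
      (∀ c, SMulInvariantMeasure (cmDatum L N H).Adelic _ (μC c) ∧
        IsFiniteMeasureOnCompacts (μC c) ∧ μC c ≠ 0) ∧
      ∀ F : C_c((cmDatum L N H).Adelic, ℂ),
        (Function.support fun c : ConjClasses (cmDatum L N H).Rational =>
          ((C : ℝ) : ℂ) * ((dc (e c)).toReal : ℂ) * ∫ y, descConj
            ((Quotient.out (e c) : (cmDatum L N H).arithmeticSubgroup) : (cmDatum L N H).Adelic)
            (Subgroup.centralizer ({((Quotient.out (e c) : (cmDatum L N H).arithmeticSubgroup) :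
              (cmDatum L N H).Adelic)} : Set (cmDatum L N H).Adelic))
            (fun _ hg => Subgroup.mem_centralizer_singleton_iff.1 hg) F y ∂(μC (e c))).Finite ∧
        diagTrace L N H μ ν hanis F =
          ∑ᶠ c : ConjClasses (cmDatum L N H).Rational,
            ((C : ℝ) : ℂ) * ((dc (e c)).toReal : ℂ) * ∫ y, descConj
              ((Quotient.out (e c) : (cmDatum L N H).arithmeticSubgroup) : (cmDatum L N H).Adelic)
              (Subgroup.centralizer ({((Quotient.out (e c) : (cmDatum L N H).arithmeticSubgroup) :
                (cmDatum L N H).Adelic)} : Set (cmDatum L N H).Adelic))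
              (fun _ hg => Subgroup.mem_centralizer_singleton_iff.1 hg) F y ∂(μC (e c)) := by
  classical
  -- the isomorphism `U(H)(L⁺) ≃* image` and the induced bijection of conjugacy classes
  obtain ⟨ι, hι⟩ : ∃ ι : (cmDatum L N H).Rational ≃* (cmDatum L N H).arithmeticSubgroup,
      ∀ γ, ((ι γ : (cmDatum L N H).arithmeticSubgroup) : (cmDatum L N H).Adelic) =
        (cmDatum L N H).toAdelic γ :=
    ⟨MonoidHom.ofInjective (cmDatum_toAdelic_injective L N H), fun _ => rfl⟩
  -- the induced bijection of conjugacy classes (`Rogawski1990.bijective_conjClassesMap_of_mulEquiv`)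
  have hbij := Literature.NumberTheory.Rogawski1990.bijective_conjClassesMap_of_mulEquiv ι
  obtain ⟨C, dc, μC, hC, hdc, hμC, hF⟩ := diagTrace_eq_finsum_orbital L N H μ ν hanis
  refine ⟨Equiv.ofBijective _ hbij, C, dc, μC, fun γ => ?_, hC, hdc, hμC, fun F => ?_⟩
  · show ConjClasses.mk (ι.toMonoidHom γ) = _
    exact congrArg ConjClasses.mk (Subtype.ext (hι γ))
  obtain ⟨hfin, hEq⟩ := hF F
  refine ⟨?_, ?_⟩
  · exact (hfin.preimage (Equiv.ofBijective _ hbij).injective.injOn)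
  · rw [hEq]
    exact (finsum_comp_equiv (Equiv.ofBijective _ hbij)).symm

/-- **T1a for the concrete kit — `θ_{G′}(F) = Σ_{𝒪_st} J(𝒪_st, F)`** (Rogawski (1990), §14.5
p. 237 (print): `J_{G′}(f′) = Σ_{𝒪_st} J(𝒪_st, f′)` with `J(𝒪_st, f′)` the sum of the class terms over
the conjugacy classes inside the stable class; `T_{G′}(f′) = J_{G′}(f′)` for the anisotropic `G′`):
with the data of `diagTrace_eq_finsum_conjClasses_rational` (bijection `e`, `C > 0`, `d_c`, `μ_c`),
for EVERY `F ∈ C_c(U(H)(𝔸_{L⁺}))` the NAMED trace functional is the finite sum over the STABLE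
classes (`Rogawski1990.StableClass (cmConjRingHom L) H`) of the stable orbital sums
(`StableClass.orbitalSum`) of the class function `Φ_F : [γ] ↦ C · d_{e[γ]} · O_{e[γ]}(F)`:

  `UnitaryGroup.diagTrace L N H μ ν hanis F = Σᶠ_{𝒪_st} 𝒪_st.orbitalSum Φ_F`

— the composition of `diagTrace_eq_finsum_conjClasses_rational` with the regrouping
`Rogawski1990.finsum_stableClass_orbitalSum`. This is the law `SimpleTraceFormula` of the floor-0
line `F0_T1InnerFormTraceIdentity` for the CONCRETE trace functional and CONCRETE grouped orbital
terms (no transfer factors, no normalisation of the constants: `a_γ` are not identified with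
Tamagawa volumes). [cite: Rogawski1990, §14.5 p. 237] -/
theorem diagTrace_eq_finsum_stableClass_orbitalSum
    (hanis : ∀ x : Fin N → L, hermForm (cmConjRingHom L) H x x = 0 → x = 0) :
    ∃ (e : ConjClasses (cmDatum L N H).Rational ≃ ConjClasses (cmDatum L N H).arithmeticSubgroup)
      (C : ℝ≥0) (dc : ConjClasses (cmDatum L N H).arithmeticSubgroup → ℝ≥0∞)
      (μC : ∀ c : ConjClasses (cmDatum L N H).arithmeticSubgroup, Measure ((cmDatum L N H).Adelic ⧸
        Subgroup.centralizer ({((Quotient.out c : (cmDatum L N H).arithmeticSubgroup) :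
          (cmDatum L N H).Adelic)} : Set (cmDatum L N H).Adelic))),
      (∀ γ : (cmDatum L N H).Rational, e (ConjClasses.mk γ) =
        ConjClasses.mk ⟨(cmDatum L N H).toAdelic γ, ⟨γ, rfl⟩⟩) ∧
      0 < C ∧ (∀ c, dc c ≠ 0 ∧ dc c ≠ ∞) ∧
      (∀ c, SMulInvariantMeasure (cmDatum L N H).Adelic _ (μC c) ∧
        IsFiniteMeasureOnCompacts (μC c) ∧ μC c ≠ 0) ∧
      ∀ F : C_c((cmDatum L N H).Adelic, ℂ),
        (Function.support fun c : ConjClasses (cmDatum L N H).Rational =>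
          ((C : ℝ) : ℂ) * ((dc (e c)).toReal : ℂ) * ∫ y, descConj
            ((Quotient.out (e c) : (cmDatum L N H).arithmeticSubgroup) : (cmDatum L N H).Adelic)
            (Subgroup.centralizer ({((Quotient.out (e c) : (cmDatum L N H).arithmeticSubgroup) :
              (cmDatum L N H).Adelic)} : Set (cmDatum L N H).Adelic))
            (fun _ hg => Subgroup.mem_centralizer_singleton_iff.1 hg) F y ∂(μC (e c))).Finite ∧
        diagTrace L N H μ ν hanis F =
          ∑ᶠ st : Literature.NumberTheory.Rogawski1990.StableClass (cmConjRingHom L) H,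
            st.orbitalSum fun c : ConjClasses (cmDatum L N H).Rational =>
              ((C : ℝ) : ℂ) * ((dc (e c)).toReal : ℂ) * ∫ y, descConj
                ((Quotient.out (e c) : (cmDatum L N H).arithmeticSubgroup) : (cmDatum L N H).Adelic)
                (Subgroup.centralizer ({((Quotient.out (e c) : (cmDatum L N H).arithmeticSubgroup) :
                  (cmDatum L N H).Adelic)} : Set (cmDatum L N H).Adelic))
                (fun _ hg => Subgroup.mem_centralizer_singleton_iff.1 hg) F y ∂(μC (e c)) := by
  obtain ⟨e, C, dc, μC, he, hC, hdc, hμC, hF⟩ :=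
    diagTrace_eq_finsum_conjClasses_rational L N H μ ν hanis
  refine ⟨e, C, dc, μC, he, hC, hdc, hμC, fun F => ?_⟩
  obtain ⟨hfin, hEq⟩ := hF F
  refine ⟨hfin, ?_⟩
  rw [hEq]
  exact (Literature.NumberTheory.Rogawski1990.finsum_stableClass_orbitalSum _ hfin).symm

/-- **Packaging for the floor-0 line's kit** (the shape its edition fold consumes, so that the kit
literal does not restate the integrand): for `H` anisotropic there is a family of CLASS FUNCTIONS
`Φ F : ConjClasses U(H)(L⁺) → ℂ` (`F ∈ C_c(U(H)(𝔸_{L⁺}))`; concretely `Φ F [γ] = C · d_{[γ]} · O_γ(F)`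
with the constant, weights and orbital measures of `diagTrace_eq_finsum_stableClass_orbitalSum`)
such that for every `F`: `Φ F` is finitely supported, the stable orbital sums
`𝒪_st ↦ 𝒪_st.orbitalSum (Φ F)` are finitely supported (`Rogawski1990.StableClass.finite_support_orbitalSum`),
and

  `UnitaryGroup.diagTrace L N H μ ν hanis F = Σᶠ_{𝒪_st} 𝒪_st.orbitalSum (Φ F)`

— with `StClass := StableClass (cmConjRingHom L) H` and `J 𝒪_st f′ := 𝒪_st.orbitalSum (Φ f′)` this is
literally the law `SimpleTraceFormula` (`θ_{G′} = J_{G′}`, finitely supported in the stable classes)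
of the line `F0_T1InnerFormTraceIdentity` for the anchored kit [Rogawski1990, §14.5 p. 237 (print)].
[cite: Rogawski1990, §14.5 p. 237] -/
theorem exists_orbitalTerms_diagTrace_eq_finsum_stableClass
    (hanis : ∀ x : Fin N → L, hermForm (cmConjRingHom L) H x x = 0 → x = 0) :
    ∃ Φ : C_c((cmDatum L N H).Adelic, ℂ) → ConjClasses (cmDatum L N H).Rational → ℂ,
      ∀ F : C_c((cmDatum L N H).Adelic, ℂ),
        (Function.support (Φ F)).Finite ∧
        (Function.support fun st : Literature.NumberTheory.Rogawski1990.StableClass (cmConjRingHom L) H =>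
          st.orbitalSum (Φ F)).Finite ∧
        diagTrace L N H μ ν hanis F =
          ∑ᶠ st : Literature.NumberTheory.Rogawski1990.StableClass (cmConjRingHom L) H,
            st.orbitalSum (Φ F) := by
  obtain ⟨e, C, dc, μC, -, -, -, -, hF⟩ :=
    diagTrace_eq_finsum_stableClass_orbitalSum L N H μ ν hanis
  refine ⟨fun F c => ((C : ℝ) : ℂ) * ((dc (e c)).toReal : ℂ) * ∫ y, descConj
      ((Quotient.out (e c) : (cmDatum L N H).arithmeticSubgroup) : (cmDatum L N H).Adelic)
      (Subgroup.centralizer ({((Quotient.out (e c) : (cmDatum L N H).arithmeticSubgroup) :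
        (cmDatum L N H).Adelic)} : Set (cmDatum L N H).Adelic))
      (fun _ hg => Subgroup.mem_centralizer_singleton_iff.1 hg) F y ∂(μC (e c)), fun F => ?_⟩
  obtain ⟨hfin, hEq⟩ := hF F
  exact ⟨hfin, Literature.NumberTheory.Rogawski1990.StableClass.finite_support_orbitalSum _ hfin, hEq⟩

end UnitaryGroup

end Literature.NumberTheory.Automorphic
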